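/-
Copyright: statement-level skeleton of a published paper (lit-balaban cell, Phase-2 proof seat p25, gen 19). No proof
claims beyond what the kernel checks below.
-/
import Literature.MathematicalPhysics.QuantumFieldTheory.BalabanImbrieJaffe1984to88.BIJ88WalkRemainderActivity312
import Literature.MathematicalPhysics.QuantumFieldTheory.BalabanImbrieJaffe1984to88.BIJ88WalkLabelPartition312

/-!
# `BalabanImbrieJaffe1984to88.BIJ88WalkRemainderCovers312` — T. Bałaban, J. Imbrie, A. Jaffe, *Effective action and
cluster properties of the abelian Higgs model*, Commun. Math. Phys. **114** (1988) 257–315 [BalabanImbrieJaffe1988],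
§5.14 p. 312 [PDF 56], verbatim (x2 render `lit-balaban-r16/renders/cmp114/original-p056-x2.png`): *"The X_{r′} are
disjoint, and each one covers at least one X_{σ_1}, the support of one of the observables F^{m̄}_{k,loc}."* — **EVERY
BLOCK AND EVERY REMAINDER COMPONENT OF THE COVARIANCE-SPLIT EXPANSION CARRIES AN OBSERVABLE AND COVERS ITS CUBES**
(p25 gen 19; the object clause (H1) of the owner's head question for `BIJ88WalkIneq312Remainder`; v1.1 APPEND-ONLY §2: the
count `#𝒳 ≤ #K`; §1 untouched): along
`BIJ88WalkExpansion311.expand` every block `X_c` and every set-aside component `X_r` has a NONEMPTY label set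
(`expand_lab_nonempty`; from nothing set aside, `expand_lab_nonempty_init`), the labels of a term from nothing set
aside lie in `K` (`lab_subset_init`), the cubes of a component contain the cubes `oc j` of each of its observables
(`oc_subset_cubes`); hence every member `(Λ_r, X_r)` of the located remainder family `rloc t` of a term of
`expand 0 K` satisfies `∃ j ∈ K, j ∈ Λ_r ∧ oc j ⊆ X_r` (`rloc_covers_init`) — print's *"each one covers at least one
X_{σ_1}"* for the located remainder families of `BIJ88WalkRemainderActivity312` / `BIJ88WalkIneq312Remainder`
(the disjointness half is `BIJ88WalkLabelPartition312.expand_labDisj_init` on the labels; the cube sets of distinct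
remainder components of one term need not be disjoint in this bookkeeping — print's `X_{r′}` are formed later).

statement-level skeleton of published theorems with citation tags; proofs where landed; nothing here is a claim
about the Yang–Mills mass gap

PDF held: `paper:balaban1988-cmp114-bij-abelian-higgs-effective-action` (journal page = PDF page + 256); p. 312 =
PDF 56 (`p0056.txt` L18–19; x2 render re-read this session, 2026-08-23).

CITATION HEADER (lean-in-tree rule).  lit-balaban cell (HOME `run/shared/lean/pub/lit-balaban/`), Phase 2, seat p25
gen 19; row **C2.Claim@312** of `HOME/lit-balaban-r16/ROWS-C2-part2.md` (owner r16, referee ref-5; head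
`BIJ88Sect5StatementsPart4.Ineq312` untouched here — MEMBER of the row, serving clause (H1)).  USED BY NAME, nothing
restated: `BIJ88WalkExpansion311.{expand, expand_of_nonempty, expand_of_not_nonempty, oact, WTerm.addConst}`,
`BIJ88WalkRunEnv311.{run_mono, run_done_le, run_rest_subset}`, `BIJ88WalkResummation312.expand_lab`,
`BIJ88WalkGeometry311.{cubes, mem_cubes}`, `BIJ88WalkRemainderActivity312.{rloc, card_rloc}`,
`BIJ88WalkLabelPartition312.expand_labDisj_init` (p25 gen 18–19).

## What is proved (0 `sorry`, standard axioms, no new `Prop` facts; theorems only)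

* **`expand_lab_nonempty`**, `expand_lab_nonempty_init`, `lab_subset_init`, `oc_subset_cubes`, **`rloc_covers_init`**.
* §2 (v1.1, append-only): `sum_card_lab_eq_card_sup` (pairwise disjoint label sets: `Σ_X #lab X = #⋃_X lab X`),
  **`card_consts_add_groups_le`** (a term of `expand 0 K` has at most `#K` blocks and remainder components — they
  carry nonempty, pairwise disjoint label sets drawn from `K`), **`card_rloc_le`** (`#𝒳 ≤ #K` for its located
  remainder family: print's *"each one covers at least one X_{σ_1}"* read as a count).
HONEST SCOPE: bookkeeping on the records of the abstract expansion (contraction-graph components); nothing analytic.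
NOT summit progress; NOT continuum; NOT Clay.  Imports `BIJ88WalkRemainderActivity312`, `BIJ88WalkLabelPartition312` (v1.1);
modifies nothing.
-/

noncomputable section

namespace Literature.MathematicalPhysics.QuantumFieldTheory.BalabanImbrieJaffe1984to88.BIJ88WalkRemainderCovers312

open Classical Matrix Finset
open scoped BigOperators
open BIJ88LabelledRun311 (mem_mbind)
open BIJ88WalkRun311 BIJ88WalkRunEnv311 BIJ88WalkGeometry311 BIJ88WalkExpansion311 BIJ88WalkResummation312
  BIJ88WalkRemainderActivity312

variable {S : Type} [Fintype S] {ι : Type} [Fintype ι] {κ : Type} [LinearOrder κ] {P : Type} [Fintype P]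
  {β : Type} [DecidableEq β]
variable {Cov : P → Matrix S S ℝ} {trig : P → Bool} {f : S → ℝ} {c : ι → ℝ} {legs : ι → List (S → ℝ)}
  {obs : κ → List (S → ℝ)} {M : ℕ} {oc : κ → Finset β} {vc : ι → Finset β} {reg : P → Finset β}

/-- **EVERY BLOCK AND EVERY SET-ASIDE COMPONENT CARRIES AN OBSERVABLE**: along the expansion from an environment whose
set-aside components have nonempty label sets, every block `X_c` and every set-aside component of every term has a
nonempty label set (a component starts as the pristine component of an observable and labels only grow along a run).
[cite: BalabanImbrieJaffe1988, §5.14 p.311–312] -/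
theorem expand_lab_nonempty : ∀ (n : ℕ) (done : Multiset (WGrp S κ ι P)) (rest : Finset κ), rest.card < n →
    (∀ h ∈ done, h.lab.Nonempty) → ∀ t ∈ expand Cov trig f c legs obs M done rest,
      ∀ X ∈ t.consts + t.groups, X.lab.Nonempty
  | 0, _, _, hn => fun _ _ _ => absurd hn (Nat.not_lt_zero _)
  | n + 1, done, rest, hn => by
    intro hd t ht
    by_cases h : rest.Nonempty
    · rw [expand_of_nonempty Cov trig f c legs obs M h, mem_mbind] at ht
      obtain ⟨o, ho, ht⟩ := ht
      have hcard : o.rest.card < n := lt_of_lt_of_le (lt_of_le_of_lt (Finset.card_le_card (run_rest_subset _ _ _ o ho))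
        (Finset.card_erase_lt_of_mem (rest.min'_mem h))) (Nat.lt_succ_iff.1 hn)
      have hdo : ∀ h ∈ o.done, h.lab.Nonempty :=
        fun h hh => hd h (Multiset.mem_of_le (run_done_le _ _ _ o ho) hh)
      have hg : o.g.lab.Nonempty := by
        have hsub := (run_mono _ _ _ o ho).2.2.1
        exact ⟨rest.min' h, hsub (by simp [pristine])⟩
      split_ifs at ht with hc
      · rw [Multiset.mem_map] at ht
        obtain ⟨t', ht', rfl⟩ := ht
        have IH := expand_lab_nonempty n o.done o.rest hcard hdo t' ht'
        intro X hX
        simp only [WTerm.addConst_consts, WTerm.addConst_groups, oact_consts, oact_groups, Multiset.cons_add,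
          Multiset.mem_cons] at hX
        rcases hX with rfl | hX
        · exact hg
        · exact IH X hX
      · rw [Multiset.mem_map] at ht
        obtain ⟨t', ht', rfl⟩ := ht
        have hdo' : ∀ h ∈ o.g ::ₘ o.done, h.lab.Nonempty := fun h hh => by
          rcases Multiset.mem_cons.1 hh with rfl | hh
          · exact hg
          · exact hdo h hh
        have IH := expand_lab_nonempty n _ o.rest hcard hdo' t' ht'
        simpa only [oact_consts, oact_groups] using IH
    · rw [expand_of_not_nonempty Cov trig f c legs obs M h, Multiset.mem_singleton] at ht
      subst ht
      intro X hX
      rw [zero_add] at hX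
      exact hd X hX

/-- **… for the expansion of a product of observables** (nothing set aside): every block and every remainder component
of every term of `expand 0 K` carries at least one observable. [cite: BalabanImbrieJaffe1988, §5.14 p.312] -/
theorem expand_lab_nonempty_init (K : Finset κ) :
    ∀ t ∈ expand Cov trig f c legs obs M 0 K, ∀ X ∈ t.consts + t.groups, X.lab.Nonempty :=
  expand_lab_nonempty (Cov := Cov) (trig := trig) (f := f) (c := c) (legs := legs) (obs := obs) (M := M) _ 0 K
    (Nat.lt_succ_self _) (fun _ hh => absurd hh (Multiset.notMem_zero _))

/-- The labels of the blocks and remainder components of a term of `expand 0 K` are observables of `K`.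
[cite: BalabanImbrieJaffe1988, §5.14 p.312] -/
theorem lab_subset_init (K : Finset κ) :
    ∀ t ∈ expand Cov trig f c legs obs M 0 K, ∀ X ∈ t.consts + t.groups, X.lab ⊆ K := by
  intro t ht X hX
  have hlab := expand_lab (Cov := Cov) (trig := trig) (f := f) (c := c) (legs := legs) (obs := obs) (M := M)
    _ 0 K (Nat.lt_succ_self _) t ht
  rw [Multiset.map_zero, Multiset.sup_zero, Finset.bot_eq_empty, Finset.empty_union] at hlab
  rw [← hlab]
  exact Multiset.le_sup (Multiset.mem_map_of_mem _ hX)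

omit [Fintype S] [Fintype ι] [LinearOrder κ] [Fintype P] in
/-- The cubes of a component contain the cubes of each of its observables. [cite: BalabanImbrieJaffe1988, §5.14 p.311] -/
theorem oc_subset_cubes {X : WGrp S κ ι P} {j : κ} (hj : j ∈ X.lab) : oc j ⊆ cubes oc vc reg X :=
  fun x hx => (mem_cubes oc vc reg X x).2 (Or.inl ⟨j, hj, hx⟩)

/-- **EACH MEMBER OF A LOCATED REMAINDER FAMILY COVERS THE SUPPORT OF ONE OF ITS OBSERVABLES** (*"each one covers at
least one X_{σ_1}, the support of one of the observables"*): for every term of `expand 0 K` and every member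
`(Λ_r, X_r)` of its located remainder family, some observable `j ∈ K` has `j ∈ Λ_r` and `oc j ⊆ X_r`.
[cite: BalabanImbrieJaffe1988, §5.14 p.312] -/
theorem rloc_covers_init (K : Finset κ) :
    ∀ t ∈ expand Cov trig f c legs obs M 0 K, ∀ LX ∈ rloc oc vc reg t, ∃ j ∈ K, j ∈ LX.1 ∧ oc j ⊆ LX.2 := by
  intro t ht LX hLX
  obtain ⟨X, hX, rfl⟩ := Multiset.mem_map.1 hLX
  have hX' : X ∈ t.consts + t.groups := Multiset.mem_add.2 (Or.inr hX)
  obtain ⟨j, hj⟩ := expand_lab_nonempty_init (Cov := Cov) (trig := trig) (f := f) (c := c) (legs := legs)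
    (obs := obs) (M := M) K t ht X hX'
  exact ⟨j, lab_subset_init (Cov := Cov) (trig := trig) (f := f) (c := c) (legs := legs) (obs := obs) (M := M) K t
    ht X hX' hj, hj, oc_subset_cubes hj⟩

/-! ## §2 (v1.1, append-only)  At most `#K` blocks and remainder components -/

omit [Fintype S] [Fintype ι] [LinearOrder κ] [Fintype P] in
/-- Membership in a union over a multiset (bookkeeping). [folklore] -/
private theorem mem_msup'' [DecidableEq κ] {m : Multiset (Finset κ)} {x : κ} : x ∈ m.sup ↔ ∃ v ∈ m, x ∈ v := by
  induction m using Multiset.induction_on with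
  | empty => simp
  | cons a m ih => simp [Multiset.sup_cons, ih, or_and_right, exists_or]

omit [Fintype S] [Fintype ι] [LinearOrder κ] [Fintype P] in
/-- **Pairwise disjoint label sets add up**: `Σ_{X∈m} #lab X = #(⋃_{X∈m} lab X)`. [cite: BalabanImbrieJaffe1988, §5.14 p.312] -/
theorem sum_card_lab_eq_card_sup [DecidableEq κ] :
    ∀ m : Multiset (WGrp S κ ι P), (∀ X ∈ m, ∀ Y ∈ m.erase X, Disjoint X.lab Y.lab) →
      (m.map fun X => X.lab.card).sum = ((m.map WGrp.lab).sup).card := by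
  intro m
  induction m using Multiset.induction_on with
  | empty => intro; simp
  | cons g m ih =>
    intro hd
    have hdm : ∀ X ∈ m, ∀ Y ∈ m.erase X, Disjoint X.lab Y.lab := fun X hX Y hY =>
      hd X (Multiset.mem_cons_of_mem hX) Y (by
        rw [Multiset.erase_cons_tail_of_mem hX]; exact Multiset.mem_cons_of_mem hY)
    have hg : Disjoint g.lab (m.map WGrp.lab).sup := by
      refine Finset.disjoint_left.2 fun x hx hx' => ?_
      obtain ⟨v, hv, hxv⟩ := mem_msup''.1 hx'
      obtain ⟨Y, hY, rfl⟩ := Multiset.mem_map.1 hv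
      exact Finset.disjoint_left.1 (hd g (Multiset.mem_cons_self _ _) Y (by rwa [Multiset.erase_cons_head])) hx hxv
    rw [Multiset.map_cons, Multiset.sum_cons, ih hdm, Multiset.map_cons, Multiset.sup_cons, Finset.sup_eq_union,
      Finset.card_union_of_disjoint hg]

/-- **A TERM OF `expand 0 K` HAS AT MOST `#K` BLOCKS AND REMAINDER COMPONENTS**: their label sets are nonempty
(`expand_lab_nonempty_init`), pairwise disjoint (`BIJ88WalkLabelPartition312.expand_labDisj_init`) and exhaust `K`
(`BIJ88WalkResummation312.expand_lab`). [cite: BalabanImbrieJaffe1988, §5.14 p.312] -/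
theorem card_consts_add_groups_le (K : Finset κ) :
    ∀ t ∈ expand Cov trig f c legs obs M 0 K, Multiset.card (t.consts + t.groups) ≤ K.card := by
  intro t ht
  have hne := expand_lab_nonempty_init (Cov := Cov) (trig := trig) (f := f) (c := c) (legs := legs) (obs := obs)
    (M := M) K t ht
  have hdisj := BIJ88WalkLabelPartition312.expand_labDisj_init (Cov := Cov) (trig := trig) (f := f) (c := c)
    (legs := legs) (obs := obs) (M := M) K t ht
  have hlab := expand_lab (Cov := Cov) (trig := trig) (f := f) (c := c) (legs := legs) (obs := obs) (M := M)
    _ 0 K (Nat.lt_succ_self _) t ht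
  rw [Multiset.map_zero, Multiset.sup_zero, Finset.bot_eq_empty, Finset.empty_union] at hlab
  have h1 : Multiset.card (t.consts + t.groups) = ((t.consts + t.groups).map fun _ => 1).sum := by
    simp
  rw [h1, ← hlab, ← sum_card_lab_eq_card_sup _ hdisj]
  exact Multiset.sum_map_le_sum_map _ _ fun X hX => Finset.card_pos.2 (hne X hX)

/-- **`#𝒳 ≤ #K`**: the located remainder family of a term of `expand 0 K` has at most `#K` members (*"each one
covers at least one X_{σ_1}"*, counted). [cite: BalabanImbrieJaffe1988, §5.14 p.312] -/
theorem card_rloc_le (K : Finset κ) :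
    ∀ t ∈ expand Cov trig f c legs obs M 0 K, Multiset.card (rloc oc vc reg t) ≤ K.card := by
  intro t ht
  rw [card_rloc]
  exact le_trans (Multiset.card_le_card (Multiset.le_add_left _ _))
    (card_consts_add_groups_le (Cov := Cov) (trig := trig) (f := f) (c := c) (legs := legs) (obs := obs) (M := M) K t ht)

end Literature.MathematicalPhysics.QuantumFieldTheory.BalabanImbrieJaffe1984to88.BIJ88WalkRemainderCovers312

end
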